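import Summits.MatrixMultiplication.MatrixMultiplication.Theorems.SoloInformedSameValue

/-!
# The exception calculus: unstarred triples of a 2-classed box are alone in their fibre (every chart)

This work, §8.8 (T12) (gen 107), THEOREM 8.18. Setting of `SoloInformedTransfer`. Suppose on a box
`I₁ × J₁ × K₁` each matrix is 2-classed — `a ∈ {[p], [p']}`, `b ∈ {[q], [q']}`, `c ∈ {[u], [u']}` — and the
admissibility table of the six classes is the "exception table": the unstarred and singly-starred combinations
`(p,q,u), (p',q,u), (p,q',u), (p,q,u')` are admissible and the doubly-starred ones `(p',q',u), (p',q,u'), (p,q',u')`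
are not (this is what the pins force when `a`, `b`, `c` are near-constant of classes `p ~ v'`, `q ~ v`,
`u ∈ {[v'+v],[v'-v]}` with generic `v, v'`, §8.8 (T12)(e)). Then an UNSTARRED triple `(i,j,k)` (classes `p, q, u`)
shares its chart fibre with no other triple of the box (`Data.eq_of_unstarred`): the two separations force
`b j' k ~ q'`, `c k' i' ~ u'`, `a i' j' ~ p'`, `b j k' ~ q'`, then `E(i',j',k)`, `E(i',j,k)` force `c k i' ~ u'`,
`a i' j ~ p`, and `E(i',j,k')` reads `Adm p q' u'` — excluded. Hence (`Data.card_unstarred_le`) the number of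
unstarred triples of the box is at most `|S⁰|`. References: this work §8.8; CohnUmans2013 Def. 12.
-/

namespace Summit.MatrixMultiplication.MatrixMultiplication.Theorems.TwistedTPP

namespace FibreLines

variable {ι G : Type*} [AddCommGroup G]

/-- Transport of admissibility along sign-equivalence in all three slots. -/
theorem Adm.of_signEq₃ {p q u x y z : G} (h : Adm p q u) (hx : SignEq x p) (hy : SignEq y q)
    (hz : SignEq z u) : Adm x y z :=
  ((h.of_signEq_left hx.symm).of_signEq_mid hy.symm).of_signEq_right hz.symm

variable {G₀ : Type*} [AddCommGroup G₀]

/-- **THEOREM 8.18 (exception calculus, every chart).** In a 2-classed box with the exception table, an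
unstarred triple is alone in its fibre (the row index `i` of the unstarred triple need not even lie in the
box). [this work, §8.8 (T12)(e)] -/
theorem Data.eq_of_unstarred (D : Data ι G) (Φ : Chart ι G₀) (hsep : D.SepAll Φ)
    {p p' q q' u u' : G} (t0 : Adm p q u) (ta : Adm p' q u) (tb : Adm p q' u) (tc : Adm p q u')
    (nab : ¬ Adm p' q' u) (nac : ¬ Adm p' q u') (nbc : ¬ Adm p q' u')
    (I₁ J₁ K₁ : Set ι) (ha : ∀ i ∈ I₁, ∀ j ∈ J₁, SignEq (D.a i j) p ∨ SignEq (D.a i j) p')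
    (hb : ∀ j ∈ J₁, ∀ k ∈ K₁, SignEq (D.b j k) q ∨ SignEq (D.b j k) q')
    (hc : ∀ k ∈ K₁, ∀ i ∈ I₁, SignEq (D.c k i) u ∨ SignEq (D.c k i) u')
    {i j k i' j' k' : ι} (hj : j ∈ J₁) (hk : k ∈ K₁) (hi' : i' ∈ I₁) (hj' : j' ∈ J₁)
    (hk' : k' ∈ K₁) (hpa : SignEq (D.a i j) p) (hqb : SignEq (D.b j k) q) (huc : SignEq (D.c k i) u)
    (hF : Φ.F i j k = Φ.F i' j' k') : (i, j, k) = (i', j', k') := by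
  by_contra hne
  have s1 := hsep i j k i' j' k' hF hne
  have s2 := hsep i' j' k' i j k hF.symm (fun h => hne h.symm)
  rw [D.sep_iff_not_adm] at s1 s2
  -- s1 : ¬ Adm (a i j) (b j' k) (c k' i') ;  s2 : ¬ Adm (a i' j') (b j k') (c k i)
  have hb1 : SignEq (D.b j' k) q' := by
    rcases hb j' hj' k hk with h | h
    · rcases hc k' hk' i' hi' with h' | h'
      · exact absurd (t0.of_signEq₃ hpa h h') s1
      · exact absurd (tc.of_signEq₃ hpa h h') s1
    · exact h
  have hc1 : SignEq (D.c k' i') u' := by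
    rcases hc k' hk' i' hi' with h' | h'
    · exact absurd (tb.of_signEq₃ hpa hb1 h') s1
    · exact h'
  have ha2 : SignEq (D.a i' j') p' := by
    rcases ha i' hi' j' hj' with h | h
    · rcases hb j hj k' hk' with h' | h'
      · exact absurd (t0.of_signEq₃ h h' huc) s2
      · exact absurd (tb.of_signEq₃ h h' huc) s2
    · exact h
  have hb2 : SignEq (D.b j k') q' := by
    rcases hb j hj k' hk' with h' | h'
    · exact absurd (ta.of_signEq₃ ha2 h' huc) s2
    · exact h'
  -- E(i', j', k) forces c k i' ~ u'
  have hc3 : SignEq (D.c k i') u' := by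
    rcases hc k hk i' hi' with h | h
    · exact absurd (((D.adm_eqn i' j' k).of_signEq_left ha2).of_signEq_mid hb1 |>.of_signEq_right h) nab
    · exact h
  -- E(i', j, k) forces a i' j ~ p
  have ha3 : SignEq (D.a i' j) p := by
    rcases ha i' hi' j hj with h | h
    · exact h
    · exact absurd (((D.adm_eqn i' j k).of_signEq_left h).of_signEq_mid hqb |>.of_signEq_right hc3) nac
  -- E(i', j, k') reads Adm p q' u'
  exact nbc ((((D.adm_eqn i' j k').of_signEq_left ha3).of_signEq_mid hb2).of_signEq_right hc1)

/-- **Counting form of THEOREM 8.18.** The unstarred triples of the box inject into `S⁰` under the chart map;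
hence their number is at most `|S⁰|` (and the rank `r · |S⁰|` is at least that number). [this work, §8.8 (T12)(e)] -/
theorem Data.card_unstarred_le [Fintype G₀] [DecidableEq G₀] [DecidableEq ι] [DecidableEq G]
    (D : Data ι G) (Φ : Chart ι G₀) (hsep : D.SepAll Φ)
    {p p' q q' u u' : G} (t0 : Adm p q u) (ta : Adm p' q u) (tb : Adm p q' u) (tc : Adm p q u')
    (nab : ¬ Adm p' q' u) (nac : ¬ Adm p' q u') (nbc : ¬ Adm p q' u')
    (I₁ J₁ K₁ : Finset ι) (ha : ∀ i ∈ I₁, ∀ j ∈ J₁, SignEq (D.a i j) p ∨ SignEq (D.a i j) p')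
    (hb : ∀ j ∈ J₁, ∀ k ∈ K₁, SignEq (D.b j k) q ∨ SignEq (D.b j k) q')
    (hc : ∀ k ∈ K₁, ∀ i ∈ I₁, SignEq (D.c k i) u ∨ SignEq (D.c k i) u') :
    ((I₁ ×ˢ J₁ ×ˢ K₁).filter fun t => (D.a t.1 t.2.1 = p ∨ D.a t.1 t.2.1 = -p) ∧
        (D.b t.2.1 t.2.2 = q ∨ D.b t.2.1 t.2.2 = -q) ∧ (D.c t.2.2 t.1 = u ∨ D.c t.2.2 t.1 = -u)).card
      ≤ Fintype.card G₀ := by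
  classical
  rw [← Finset.card_univ]
  refine Finset.card_le_card_of_injOn (fun t => Φ.F t.1 t.2.1 t.2.2) (fun _ _ => Finset.mem_univ _) ?_
  intro t ht t' ht' hF
  rw [Finset.coe_filter, Set.mem_setOf_eq, Finset.mem_product, Finset.mem_product] at ht ht'
  obtain ⟨⟨-, hj, hk⟩, hpa, hqb, huc⟩ := ht
  obtain ⟨⟨hi', hj', hk'⟩, -, -, -⟩ := ht'
  have h := D.eq_of_unstarred Φ hsep t0 ta tb tc nab nac nbc (↑I₁) (↑J₁) (↑K₁)
    (fun i hi j hj => ha i hi j hj) (fun j hj k hk => hb j hj k hk) (fun k hk i hi => hc k hk i hi)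
    hj hk hi' hj' hk' hpa hqb huc hF
  obtain ⟨a1, a2, a3⟩ := t
  obtain ⟨b1, b2, b3⟩ := t'
  simp only [Prod.mk.injEq] at h ⊢
  exact ⟨h.1, h.2.1, h.2.2⟩

end FibreLines

end Summit.MatrixMultiplication.MatrixMultiplication.Theorems.TwistedTPP
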